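import Summits.Parity.GeneralizedHardyLittlewood.Theorems.BeyondDiagonalBeatsQuarter.KernelFormXSqSums
import Literature.NumberTheory.Sieve.MoebiusExpSum
import Literature.NumberTheory.LFunctions.SiegelWalfiszLiouville
import HarnessLib

/-!
# Route `PrimeLevelFamEdge`, crux K_B (stmt-Parity-20343), line `diagonal_kernel_split`, helper H1
# (`CornerNegligibleXSq`), part 7: the outer `(c, d)`-sums and the choice of the threshold

Elementary bookkeeping for the final corner estimate (part 8):
* `sum_sum_divWeight_div_mul_le` — `Σ_{cd ≤ N} D(cd)/(cd) ≤ (1 + log N)⁴` (`D ≤ τ`, `Σ τ²/n ≤ (1+log N)⁴`,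
  tree `MoebiusExpSum.sum_sq_card_divisors_div_le`);
* `sum_sum_divWeight_div_mul_sq_le` — `Σ_{cd ≤ N} D(cd)/(cd²) ≤ Z₂(2 + log N)` (`Σ_{d∣n} 1/d ≤ D(n)`,
  tree `KernelFormXSq.sum_divWeight_sq_div_le`);
* `exp_neg_mul_le_div_pow` — `e^{−at} ≤ C/(1+t)^k` (`t ≥ 0`);
* `floor_rpow_facts` — with `K₁ = ⌊Q^{s}⌋`, `Q ≥ 1`, `s > 0`: `1 + log K₁ ≥ s·log Q`; `rpow_neg_le_div_log_pow`.
Helper toward the heart stub (plan Ω, H1); closes nothing; standard axioms.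
«The programme SEARCHES and TYPES; no claim about Landau–Siegel zeros, Theorems 1–2 of
arXiv:2211.02515 or a repaired Margin232 until a kernel theorem says so.»
-/

noncomputable section

open scoped Real
open Finset ArithmeticFunction

namespace Summit.Parity.GeneralizedHardyLittlewood.Theorems.BeyondDiagonalBeatsQuarter.Corner

open Literature.NumberTheory.LFunctions
open Literature.Barriers.Parity (Icc_one_eq_Ioc_zero)
open KernelFormXSq (divWeight divWeight_nonneg sum_divWeight_sq_div_le exp_neg_sqrt_le_div_pow)

/-! ### `D(n)` against `τ(n)` and `Σ_{d∣n} 1/d` -/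

/-- `D(n) ≤ τ(n)` (`d^{−3/4} ≤ 1`). [folklore] -/
theorem divWeight_le_card_divisors (n : ℕ) : divWeight n ≤ (n.divisors.card : ℝ) := by
  unfold divWeight
  have h : ∀ d ∈ n.divisors, (d : ℝ) ^ (-(3 / 4 : ℝ)) ≤ 1 := by
    intro d hd
    have hd1 : (1 : ℝ) ≤ d := by exact_mod_cast Nat.pos_of_mem_divisors hd
    exact Real.rpow_le_one_of_one_le_of_nonpos hd1 (by norm_num)
  calc ∑ d ∈ n.divisors, (d : ℝ) ^ (-(3 / 4 : ℝ)) ≤ ∑ _d ∈ n.divisors, (1 : ℝ) := Finset.sum_le_sum h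
    _ = (n.divisors.card : ℝ) := by simp

/-- `Σ_{d∣n} 1/d ≤ D(n)` (`d⁻¹ ≤ d^{−3/4}` for `d ≥ 1`). [folklore] -/
theorem sum_divisors_inv_le_divWeight (n : ℕ) : ∑ d ∈ n.divisors, ((d : ℝ))⁻¹ ≤ divWeight n := by
  unfold divWeight
  refine Finset.sum_le_sum fun d hd ↦ ?_
  have hd1 : (1 : ℝ) ≤ d := by exact_mod_cast Nat.pos_of_mem_divisors hd
  rw [← Real.rpow_neg_one]
  exact Real.rpow_le_rpow_of_exponent_le hd1 (by norm_num)

/-! ### The two outer sums -/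

/-- Reindexing `Σ_{c ≤ N} Σ_{d ≤ N/c} F(c,d) = Σ_{n ≤ N} Σ_{d ∣ n} F(n/d, d)`. [folklore] -/
theorem sum_sum_div_eq_sum_divisors (N : ℕ) (F : ℕ → ℕ → ℝ) :
    ∑ c ∈ Icc 1 N, ∑ d ∈ Icc 1 (N / c), F c d = ∑ n ∈ Icc 1 N, ∑ d ∈ n.divisors, F (n / d) d := by
  have h := SiegelWalfiszLiouville.sum_Ioc_sum_divisorsAntidiagonal_eq F N
  rw [Icc_one_eq_Ioc_zero]
  have hL : ∀ c ∈ Ioc 0 N, ∑ d ∈ Icc 1 (N / c), F c d = ∑ d ∈ Ioc 0 (N / c), F c d :=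
    fun c _ ↦ by rw [Icc_one_eq_Ioc_zero]
  rw [Finset.sum_congr rfl hL, ← h]
  refine Finset.sum_congr rfl fun n _ ↦ ?_
  exact Nat.sum_divisorsAntidiagonal' (fun a b ↦ F a b)

/-- **`Σ_{c ≤ N} Σ_{d ≤ N/c} D(cd)/(cd) ≤ (1 + log N)⁴.`** [folklore] -/
theorem sum_sum_divWeight_div_mul_le (N : ℕ) :
    ∑ c ∈ Icc 1 N, ∑ d ∈ Icc 1 (N / c), divWeight (c * d) / ((c : ℝ) * d) ≤ (1 + Real.log N) ^ 4 := by
  rw [sum_sum_div_eq_sum_divisors N (fun c d ↦ divWeight (c * d) / ((c : ℝ) * d))]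
  have h1 : ∀ n ∈ Icc 1 N, ∑ d ∈ n.divisors, divWeight (n / d * d) / (((n / d : ℕ) : ℝ) * d) =
      (n.divisors.card : ℝ) * (divWeight n / n) := by
    intro n hn
    have h : ∀ d ∈ n.divisors, divWeight (n / d * d) / (((n / d : ℕ) : ℝ) * d) = divWeight n / n := by
      intro d hd
      have hdn : d ∣ n := Nat.dvd_of_mem_divisors hd
      rw [Nat.div_mul_cancel hdn]
      congr 1
      rw [← Nat.cast_mul, Nat.div_mul_cancel hdn]
    rw [Finset.sum_congr rfl h, Finset.sum_const, nsmul_eq_mul]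
  rw [Finset.sum_congr rfl h1]
  have h2 : ∀ n ∈ Icc 1 N, (n.divisors.card : ℝ) * (divWeight n / n) ≤
      ((n.divisors.card : ℕ) : ℝ) ^ 2 / n := by
    intro n hn
    have hn0 : (0 : ℝ) < n := by exact_mod_cast (Finset.mem_Icc.1 hn).1
    rw [sq, mul_div_assoc]
    exact mul_le_mul_of_nonneg_left (div_le_div_of_nonneg_right (divWeight_le_card_divisors n) hn0.le)
      (by positivity)
  refine (Finset.sum_le_sum h2).trans ?_
  rw [Icc_one_eq_Ioc_zero]
  exact Literature.NumberTheory.Sieve.MoebiusExpSum.sum_sq_card_divisors_div_le N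

/-- **`Σ_{c ≤ N} Σ_{d ≤ N/c} D(cd)/(cd²) ≤ Z₂·(2 + log N)`** (`N ≥ 1`; `Z₂ = (Σ d^{−5/4})²`). [folklore] -/
theorem sum_sum_divWeight_div_mul_sq_le {N : ℕ} (hN : 1 ≤ N) :
    ∑ c ∈ Icc 1 N, ∑ d ∈ Icc 1 (N / c), divWeight (c * d) / ((c : ℝ) * d ^ 2) ≤
      (∑' d : ℕ, (d : ℝ) ^ (-(5 / 4 : ℝ))) ^ 2 * (2 + Real.log N) := by
  rw [sum_sum_div_eq_sum_divisors N (fun c d ↦ divWeight (c * d) / ((c : ℝ) * d ^ 2))]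
  have h1 : ∀ n ∈ Icc 1 N, ∑ d ∈ n.divisors, divWeight (n / d * d) / (((n / d : ℕ) : ℝ) * d ^ 2) =
      divWeight n / n * ∑ d ∈ n.divisors, ((d : ℝ))⁻¹ := by
    intro n hn
    rw [Finset.mul_sum]
    refine Finset.sum_congr rfl fun d hd ↦ ?_
    have hdn : d ∣ n := Nat.dvd_of_mem_divisors hd
    have hd0 : (d : ℝ) ≠ 0 := by exact_mod_cast Nat.pos_of_mem_divisors hd |>.ne'
    have hn0 : (n : ℝ) ≠ 0 := by exact_mod_cast (show 0 < n from (Finset.mem_Icc.1 hn).1).ne'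
    rw [Nat.div_mul_cancel hdn]
    have : ((n / d : ℕ) : ℝ) * (d : ℝ) ^ 2 = n * d := by
      rw [sq, ← mul_assoc, ← Nat.cast_mul, Nat.div_mul_cancel hdn]
    rw [this]
    field_simp
  rw [Finset.sum_congr rfl h1]
  have h2 : ∀ n ∈ Icc 1 N, divWeight n / n * ∑ d ∈ n.divisors, ((d : ℝ))⁻¹ ≤ divWeight n ^ 2 / n := by
    intro n hn
    have hn0 : (0 : ℝ) < n := by exact_mod_cast (Finset.mem_Icc.1 hn).1
    rw [sq, mul_div_assoc, mul_comm (divWeight n) (divWeight n / n)]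
    exact mul_le_mul_of_nonneg_left (sum_divisors_inv_le_divWeight n)
      (div_nonneg (divWeight_nonneg n) hn0.le)
  exact (Finset.sum_le_sum h2).trans (sum_divWeight_sq_div_le hN)

/-! ### Powers of logarithms against powers -/

/-- `e^{−at} ≤ C/(1 + t)^k` for `t ≥ 0` (`a > 0`). [folklore] -/
theorem exp_neg_mul_le_div_pow {a : ℝ} (ha : 0 < a) (k : ℕ) :
    ∃ C : ℝ, 0 < C ∧ ∀ t : ℝ, 0 ≤ t → Real.exp (-(a * t)) ≤ C / (1 + t) ^ k := by
  obtain ⟨K, hK, hKb⟩ := exp_neg_sqrt_le_div_pow ha k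
  refine ⟨Real.exp a * K, by positivity, fun t ht ↦ ?_⟩
  have hs : Real.sqrt t * Real.sqrt t = t := Real.mul_self_sqrt ht
  have h2 : -(a * t) ≤ a + -(a * Real.sqrt t) := by
    nlinarith [sq_nonneg (Real.sqrt t - 1), Real.sqrt_nonneg t]
  calc Real.exp (-(a * t)) ≤ Real.exp (a + -(a * Real.sqrt t)) := Real.exp_le_exp.2 h2
    _ = Real.exp a * Real.exp (-(a * Real.sqrt t)) := Real.exp_add _ _
    _ ≤ Real.exp a * (K / (1 + t) ^ k) := mul_le_mul_of_nonneg_left (hKb t ht) (Real.exp_pos _).le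
    _ = Real.exp a * K / (1 + t) ^ k := by ring

/-- `Q^{−s} ≤ C/(1 + log Q)^k` for `Q ≥ 1` (`s > 0`). [folklore] -/
theorem rpow_neg_le_div_log_pow {s : ℝ} (hs : 0 < s) (k : ℕ) :
    ∃ C : ℝ, 0 < C ∧ ∀ Q : ℝ, 1 ≤ Q → Q ^ (-s) ≤ C / (1 + Real.log Q) ^ k := by
  obtain ⟨C, hC, h⟩ := exp_neg_mul_le_div_pow hs k
  refine ⟨C, hC, fun Q hQ ↦ ?_⟩
  have hQ0 : 0 < Q := by linarith
  rw [Real.rpow_def_of_pos hQ0, show Real.log Q * -s = -(s * Real.log Q) by ring]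
  exact h _ (Real.log_nonneg hQ)

/-- **The threshold `K₁ = ⌊Q^s⌋`**: for `Q ≥ 1`, `s > 0`: `1 ≤ K₁`, `K₁ ≤ Q^s` and `s·log Q ≤ 1 + log K₁`
(`K₁ ≥ Q^s/2` and `1 − log 2 > 0`). [folklore] -/
theorem floor_rpow_facts {Q s : ℝ} (hQ : 1 ≤ Q) (hs : 0 < s) :
    1 ≤ ⌊Q ^ s⌋₊ ∧ (⌊Q ^ s⌋₊ : ℝ) ≤ Q ^ s ∧ s * Real.log Q ≤ 1 + Real.log (⌊Q ^ s⌋₊ : ℝ) := by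
  have hQ0 : 0 < Q := by linarith
  have hQs : 1 ≤ Q ^ s := Real.one_le_rpow hQ hs.le
  have hQs0 : 0 < Q ^ s := by linarith
  have h1 : 1 ≤ ⌊Q ^ s⌋₊ := Nat.le_floor (by simpa using hQs)
  have h2 : (⌊Q ^ s⌋₊ : ℝ) ≤ Q ^ s := Nat.floor_le hQs0.le
  refine ⟨h1, h2, ?_⟩
  have hK0 : (0 : ℝ) < ⌊Q ^ s⌋₊ := by exact_mod_cast h1
  -- K₁ ≥ Q^s / 2
  have hhalf : Q ^ s / 2 ≤ ⌊Q ^ s⌋₊ := by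
    rcases le_or_gt 2 (Q ^ s) with h | h
    · have := Nat.lt_floor_add_one (Q ^ s); linarith
    · have : (1 : ℝ) ≤ ⌊Q ^ s⌋₊ := by exact_mod_cast h1
      linarith
  have hlog : Real.log (Q ^ s / 2) ≤ Real.log (⌊Q ^ s⌋₊ : ℝ) := Real.log_le_log (by positivity) hhalf
  rw [Real.log_div hQs0.ne' two_ne_zero, Real.log_rpow hQ0] at hlog
  have hl2 : Real.log 2 < 1 := by have := Real.log_two_lt_d9; linarith
  linarith

end Summit.Parity.GeneralizedHardyLittlewood.Theorems.BeyondDiagonalBeatsQuarter.Corner
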